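import Summits.NavierStokesRegularity.NavierStokesRegularity.Theorems.ExtremiserTransienceNearExtremalTransienceExtremiserLiouvilleLogFlatCutoff
import Summits.NavierStokesRegularity.NavierStokesRegularity.Theorems.ExtremiserTransienceNearExtremalTransienceScaling
import Literature.Analysis.FluidPDE.BiotSavartCurlPair
import Mathlib.Tactic.Module
import HarnessLib

/-!
# Crux `ExtremiserTransience.NearExtremalTransience` (stmt-NavierStokesRegularity-21883), line `extremiser_liouville`,
# stub K1b — «NO GAIN FROM CONSTANTS», file 2/5: THE CONSTANT CARRIER `Φ_b = curl (χ · ½ b × x)` WITH `‖Φ_b‖ ≤ ‖b‖` EVERYWHERE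

`--supports stmt-NavierStokesRegularity-21883` (helper).  Author: prover seat `ns-el-k1b` (g0).

To transport a constant velocity `b` onto a ball at NO COST IN SUP NORM: with the log-flat cut-off `χ` of file 1/5,
`Φ_b := curl (χ · ½ b × x)` is `C^∞`, compactly supported (`tsupport ⊆ B̄_{R_K}`, `R_K = e^{K/2}`), divergence free (a curl),
equal to `b` on the open unit ball, and — the point — `‖Φ_b(x)‖ ≤ ‖b‖` for EVERY `x` (`norm_carrier_le`): by the Leibniz rule
`Φ_b = (χ + s) b − (c/2)⟪x, b⟫ x` with `s = c‖x‖²/2 ∈ [−1, 0]` (`carrier_apply`), so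
`‖Φ_b‖² = (χ+s)²‖b‖² − (2χ+s)·q`, `q = (c/2)⟪x,b⟫² ∈ [s‖b‖², 0]`, an affine function of `q` with endpoint values
`(χ+s)²‖b‖²` and `χ²‖b‖²`, both `≤ ‖b‖²`.  (A cut-off at a fixed scale without the logarithmic flattening overshoots `‖b‖`
on the transition annulus.)  The dilates `Φ_{b,L}(x) = Φ_b(x/L)` (`carrierAt b L`) keep all these properties with plateau
`‖x‖ < L` and support `B̄_{L·R_K}`, and their depletion data scale as `Z(Φ_{b,L}) = L·Z(Φ_b)`, `P(Φ_{b,L}) = P(Φ_b)/L`,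
`S(Φ_{b,L}) = S(Φ_b)` (`enstrophy_carrierAt`, `palinstrophy_carrierAt`, `stretching_carrierAt`; the tree's
`curl_smul_comp_smul`, `fderiv_const_smul_comp_smul_apply`, `integral_comp_smul_three`).

WHAT THIS IS NOT: pure vector calculus; K1b is a STATIC statement about analytic κ⋆-efficient fields; the crux NET, rung N0 and NS regularity stay OPEN — nothing here proves NS regularity. [folklore]
-/

noncomputable section

open Set Filter Topology MeasureTheory Metric
open scoped InnerProductSpace RealInnerProductSpace ENNReal NNReal ContDiff
open Literature.Analysis.FluidPDE

namespace Summit.NavierStokesRegularity.NavierStokesRegularity.Theorems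

-- the problem directory repeats the summit name (`NavierStokesRegularity/NavierStokesRegularity`)
set_option linter.dupNamespace false

namespace ExtremiserLiouville

open DepletionLadder.KStar.HalfSpace (E3)

/-! ## The carrier `Φ = curl (χ · ½ b × x)` and its dilates -/

/-- The potential `ψ_b = χ · ½ b × x`. -/
def carrierPot (b : E3) (y : E3) : E3 := logCutoff y • ((1 / 2 : ℝ) • crossCLM b y)

/-- **The unit carrier** `Φ_b = curl ψ_b` (plateau: the open unit ball). -/
def carrier (b : E3) : E3 → E3 := curl (carrierPot b)

/-- **The carrier at scale `L`**: `Φ_{b,L} = curl (L · ψ_b(·/L))` (`= Φ_b(·/L)`, plateau `‖x‖ < L`). -/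
def carrierAt (b : E3) (L : ℝ) : E3 → E3 := curl fun y => L • carrierPot b (L⁻¹ • y)

variable (b : E3)

/-- Auxiliary (`contDiff_half_cross`). [folklore] -/
theorem contDiff_half_cross : ContDiff ℝ ∞ fun y : E3 => (1 / 2 : ℝ) • crossCLM b y :=
  (crossCLM b).contDiff.const_smul _

/-- Auxiliary (`contDiff_carrierPot`). [folklore] -/
theorem contDiff_carrierPot : ContDiff ℝ ∞ (carrierPot b) :=
  contDiff_logCutoff.smul (contDiff_half_cross b)

/-- The support radius `R_K = exp (K/2)` of the unit carrier. -/
def suppRad : ℝ := Real.exp (flatK / 2)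

/-- Auxiliary (`suppRad_pos`). [folklore] -/
theorem suppRad_pos : 0 < suppRad := Real.exp_pos _

/-- Auxiliary (`one_le_suppRad`). [folklore] -/
theorem one_le_suppRad : 1 ≤ suppRad := Real.one_le_exp (by have := flatK_pos; positivity)

/-- `ψ_b = 0` off the closed ball of radius `R_K`. [folklore] -/
theorem carrierPot_eq_zero {y : E3} (hy : suppRad ≤ ‖y‖) : carrierPot b y = 0 := by
  have h : Real.exp flatK ≤ ‖y‖ ^ 2 := by
    have h1 : Real.exp flatK = suppRad ^ 2 := by
      rw [suppRad, ← Real.exp_nat_mul]; congr 1; ring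
    rw [h1]
    exact pow_le_pow_left₀ suppRad_pos.le hy 2
  rw [carrierPot, logCutoff_eq_zero h, zero_smul]

/-- Auxiliary (`hasCompactSupport_carrierPot`). [folklore] -/
theorem hasCompactSupport_carrierPot : HasCompactSupport (carrierPot b) := by
  refine HasCompactSupport.intro (isCompact_closedBall (0 : E3) suppRad) fun y hy => ?_
  rw [mem_closedBall, dist_zero_right, not_le] at hy
  exact carrierPot_eq_zero b hy.le

/-- **Explicit formula off the origin:** `Φ_b(x) = (χ + s)·b − (c/2)⟪x,b⟫·x`, `s = c‖x‖²/2`. [folklore] -/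
theorem carrier_apply {x : E3} (hx : x ≠ 0) :
    carrier b x = (logCutoff x + gradCoeff x * ‖x‖ ^ 2 / 2) • b - (gradCoeff x / 2 * ⟪x, b⟫) • x := by
  unfold carrier carrierPot
  rw [curl_smul (hasFDerivAt_logCutoff hx).differentiableAt ((contDiff_half_cross b).differentiable (by simp) x),
    DepletionLadder.KStar.HalfSpace.curl_half_cross, (hasFDerivAt_logCutoff hx).fderiv,
    curlCLM_smulRight_innerSL]
  have e1 : cross (gradCoeff x • x) ((1 / 2 : ℝ) • crossCLM b x) =
      ((1 / 2 : ℝ) * gradCoeff x) • (⟪x, x⟫ • b - ⟪x, b⟫ • x) := by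
    rw [← crossCLM_apply (gradCoeff x • x), map_smul, map_smul, FunLike.coe_smul, Pi.smul_apply, smul_smul,
      crossCLM_apply, crossCLM_apply, cross_cross_right]
  rw [e1, real_inner_self_eq_norm_sq]
  module

/-- `Φ_b = b` on the open unit ball. [folklore] -/
theorem carrier_eq_of_norm_lt_one {x : E3} (hx : ‖x‖ < 1) : carrier b x = b := by
  have hev : logCutoff =ᶠ[𝓝 x] fun _ => (1:ℝ) := by
    filter_upwards [Metric.isOpen_ball.mem_nhds (mem_ball_zero_iff.2 hx)] with y hy
    exact logCutoff_eq_one (mem_ball_zero_iff.1 hy).le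
  have hD : fderiv ℝ logCutoff x = 0 := by rw [hev.fderiv_eq, fderiv_const_apply]
  unfold carrier carrierPot
  rw [curl_smul (contDiff_logCutoff.differentiable (by simp) x) ((contDiff_half_cross b).differentiable (by simp) x),
    DepletionLadder.KStar.HalfSpace.curl_half_cross, hD, logCutoff_eq_one hx.le]
  simp

/-- **THE SHARP SUP BOUND: `‖Φ_b(x)‖ ≤ ‖b‖` for every `x`.** [folklore] -/
theorem norm_carrier_le (x : E3) : ‖carrier b x‖ ≤ ‖b‖ := by
  by_cases hx1 : ‖x‖ < 1
  · rw [carrier_eq_of_norm_lt_one b hx1]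
  have hx : x ≠ 0 := by
    intro h; rw [h, norm_zero] at hx1; exact hx1 one_pos
  rw [carrier_apply b hx]
  set χ := logCutoff x with hχ
  set c := gradCoeff x with hc
  set s := c * ‖x‖ ^ 2 / 2 with hs
  obtain ⟨hs1, hs0⟩ := flat_bounds hx
  have hχ0 := logCutoff_nonneg x
  have hχ1 := logCutoff_le_one x
  rw [← hχ] at hχ0 hχ1
  rw [← hc, ← hs] at hs1 hs0
  -- the square of the norm
  set q := c / 2 * ⟪x, b⟫ ^ 2 with hq
  have hexp : ‖(χ + s) • b - (c / 2 * ⟪x, b⟫) • x‖ ^ 2 = (χ + s) ^ 2 * ‖b‖ ^ 2 - (2 * χ + s) * q := by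
    rw [@norm_sub_sq_real, norm_smul, norm_smul, inner_smul_left, inner_smul_right, real_inner_comm x b,
      Real.norm_eq_abs, Real.norm_eq_abs, mul_pow, mul_pow, sq_abs, sq_abs, hq, hs]
    simp only [RCLike.conj_to_real]
    ring
  -- range of q
  have hcs : ⟪x, b⟫ ^ 2 ≤ ‖x‖ ^ 2 * ‖b‖ ^ 2 := by
    have h := abs_real_inner_le_norm x b
    have h' : 0 ≤ ‖x‖ * ‖b‖ := by positivity
    nlinarith [sq_abs ⟪x, b⟫, abs_nonneg ⟪x, b⟫]
  have hc0 : c ≤ 0 := by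
    have hx2 : 0 < ‖x‖ ^ 2 := by positivity
    rcases le_or_gt c 0 with h | h
    · exact h
    · have : 0 < c * ‖x‖ ^ 2 / 2 := by positivity
      linarith
  have hq0 : q ≤ 0 := by
    rw [hq]; exact mul_nonpos_of_nonpos_of_nonneg (by linarith) (sq_nonneg _)
  have hq1 : s * ‖b‖ ^ 2 ≤ q := by
    rw [hq, hs]
    have : c / 2 * (‖x‖ ^ 2 * ‖b‖ ^ 2) ≤ c / 2 * ⟪x, b⟫ ^ 2 :=
      mul_le_mul_of_nonpos_left hcs (by linarith)
    linarith
  have hsq : ‖(χ + s) • b - (c / 2 * ⟪x, b⟫) • x‖ ^ 2 ≤ ‖b‖ ^ 2 := by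
    rw [hexp]
    have hb0 : 0 ≤ ‖b‖ ^ 2 := sq_nonneg _
    rcases le_or_gt 0 (2 * χ + s) with h | h
    · -- max at q = s‖b‖²: value χ²‖b‖²
      have h1 : -((2 * χ + s) * q) ≤ -((2 * χ + s) * (s * ‖b‖ ^ 2)) := by nlinarith
      have h2 : χ ^ 2 * ‖b‖ ^ 2 ≤ ‖b‖ ^ 2 := by
        have : χ ^ 2 ≤ 1 := by nlinarith
        nlinarith
      nlinarith
    · -- max at q = 0: value (χ+s)²‖b‖²
      have h1 : -((2 * χ + s) * q) ≤ 0 := by nlinarith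
      have h2 : (χ + s) ^ 2 * ‖b‖ ^ 2 ≤ ‖b‖ ^ 2 := by
        have : (χ + s) ^ 2 ≤ 1 := by nlinarith [mul_nonneg (show 0 ≤ 1 - (χ + s) by linarith) (show 0 ≤ 1 + (χ + s) by linarith)]
        nlinarith
      nlinarith
  exact (pow_le_pow_iff_left₀ (norm_nonneg _) (norm_nonneg _) two_ne_zero).1 hsq

/-! ## The dilated carriers `Φ_{b,L}` -/

variable {L : ℝ}

/-- Auxiliary (`contDiff_carrierPotAt`). [folklore] -/
theorem contDiff_carrierPotAt (L : ℝ) : ContDiff ℝ ∞ fun y : E3 => L • carrierPot b (L⁻¹ • y) :=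
  ((contDiff_carrierPot b).comp (contDiff_const_smul L⁻¹)).const_smul L

/-- `Φ_{b,L}(x) = Φ_b(x/L)`. [folklore] -/
theorem carrierAt_eq (hL : 0 < L) (x : E3) : carrierAt b L x = carrier b (L⁻¹ • x) := by
  unfold carrierAt carrier
  rw [curl_smul_comp_smul (carrierPot b) L L⁻¹ x, mul_inv_cancel₀ hL.ne', one_smul]

/-- **`Φ_{b,L}` is `C^∞`.** [folklore] -/
theorem contDiff_carrierAt (L : ℝ) : ContDiff ℝ ∞ (carrierAt b L) := by
  unfold carrierAt
  rw [curl_eq_curlCLM_comp]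
  exact curlCLM.contDiff.comp ((contDiff_carrierPotAt b L).fderiv_right (m := ∞) le_rfl)

/-- Auxiliary (`hasCompactSupport_carrierPotAt`). [folklore] -/
theorem hasCompactSupport_carrierPotAt (hL : 0 < L) :
    HasCompactSupport fun y : E3 => L • carrierPot b (L⁻¹ • y) := by
  refine HasCompactSupport.intro (isCompact_closedBall (0 : E3) (L * suppRad)) fun y hy => ?_
  rw [mem_closedBall, dist_zero_right, not_le] at hy
  have h : suppRad ≤ ‖L⁻¹ • y‖ := by
    rw [norm_smul, Real.norm_eq_abs, abs_of_pos (inv_pos.2 hL), ← div_eq_inv_mul, le_div_iff₀ hL]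
    linarith [mul_comm L suppRad]
  show L • carrierPot b (L⁻¹ • y) = 0
  rw [carrierPot_eq_zero b h, smul_zero]

/-- **`Φ_{b,L}` is compactly supported.** [folklore] -/
theorem hasCompactSupport_carrierAt (hL : 0 < L) : HasCompactSupport (carrierAt b L) :=
  hasCompactSupport_curl (hasCompactSupport_carrierPotAt b hL)

/-- `Φ_{b,L} = 0` off the closed ball of radius `L·R_K`. [folklore] -/
theorem carrierAt_eq_zero (hL : 0 < L) {y : E3} (hy : L * suppRad < ‖y‖) : carrierAt b L y = 0 := by
  unfold carrierAt
  apply curl_eq_zero_of_notMem_tsupport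
  intro hmem
  have hsub : tsupport (fun y : E3 => L • carrierPot b (L⁻¹ • y)) ⊆ closedBall (0 : E3) (L * suppRad) := by
    refine closure_minimal (fun z hz => ?_) isClosed_closedBall
    rw [mem_closedBall, dist_zero_right]
    by_contra hlt
    rw [not_le] at hlt
    have h : suppRad ≤ ‖L⁻¹ • z‖ := by
      rw [norm_smul, Real.norm_eq_abs, abs_of_pos (inv_pos.2 hL), ← div_eq_inv_mul, le_div_iff₀ hL]
      linarith [mul_comm L suppRad]
    exact hz (by show L • carrierPot b (L⁻¹ • z) = 0; rw [carrierPot_eq_zero b h, smul_zero])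
  have := hsub hmem
  rw [mem_closedBall, dist_zero_right] at this
  linarith

/-- **`Φ_{b,L}` is divergence free** (it is a curl). [folklore] -/
theorem isDivFree_carrierAt (L : ℝ) : VectorCalculus.IsDivFree (carrierAt b L) := fun x =>
  divergence_curl_eq_zero_holds _ ((contDiff_carrierPotAt b L).of_le (by norm_cast)) x

/-- **`Φ_{b,L} = b` on the ball `‖x‖ < L`.** [folklore] -/
theorem carrierAt_eq_of_norm_lt (hL : 0 < L) {x : E3} (hx : ‖x‖ < L) : carrierAt b L x = b := by
  rw [carrierAt_eq b hL]
  apply carrier_eq_of_norm_lt_one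
  rw [norm_smul, Real.norm_eq_abs, abs_of_pos (inv_pos.2 hL), ← div_eq_inv_mul, div_lt_one hL]
  exact hx

/-- **`‖Φ_{b,L}(x)‖ ≤ ‖b‖` everywhere.** [folklore] -/
theorem norm_carrierAt_le (hL : 0 < L) (x : E3) : ‖carrierAt b L x‖ ≤ ‖b‖ := by
  rw [carrierAt_eq b hL]; exact norm_carrier_le b _

/-- `Φ_{b,L}` is locally constant `= b` on the open ball, so its derivative vanishes there. [folklore] -/
theorem carrierAt_eventuallyEq (hL : 0 < L) {x : E3} (hx : ‖x‖ < L) : carrierAt b L =ᶠ[𝓝 x] fun _ => b := by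
  filter_upwards [Metric.isOpen_ball.mem_nhds (mem_ball_zero_iff.2 hx)] with y hy
  exact carrierAt_eq_of_norm_lt b hL (mem_ball_zero_iff.1 hy)

/-! ## Scaling of the depletion data of `Φ_{b,L}` -/

/-- `curl Φ_{b,L}(x) = L⁻¹ · (curl Φ_b)(x/L)`. [folklore] -/
theorem curl_carrierAt (hL : 0 < L) (x : E3) : curl (carrierAt b L) x = L⁻¹ • curl (carrier b) (L⁻¹ • x) := by
  have h : carrierAt b L = fun y => (1:ℝ) • carrier b (L⁻¹ • y) :=
    funext fun y => by rw [one_smul, carrierAt_eq b hL]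
  rw [h, curl_smul_comp_smul, one_mul]

/-- `D Φ_{b,L}(x) = L⁻¹ · (DΦ_b)(x/L)`. [folklore] -/
theorem fderiv_carrierAt (hL : 0 < L) (x : E3) :
    fderiv ℝ (carrierAt b L) x = L⁻¹ • fderiv ℝ (carrier b) (L⁻¹ • x) := by
  have h : carrierAt b L = fun y => (1:ℝ) • carrier b (L⁻¹ • y) :=
    funext fun y => by rw [one_smul, carrierAt_eq b hL]
  rw [h, fderiv_const_smul_comp_smul_apply, one_mul]

/-- `D curl Φ_{b,L}(x) = L⁻² · (D curl Φ_b)(x/L)`. [folklore] -/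
theorem fderiv_curl_carrierAt (hL : 0 < L) (x : E3) :
    fderiv ℝ (curl (carrierAt b L)) x = (L⁻¹ * L⁻¹) • fderiv ℝ (curl (carrier b)) (L⁻¹ • x) := by
  have h : curl (carrierAt b L) = fun y => L⁻¹ • curl (carrier b) (L⁻¹ • y) := funext (curl_carrierAt b hL)
  rw [h, fderiv_const_smul_comp_smul_apply]

/-- **Enstrophy scales like `L`:** `Z(Φ_{b,L}) = L · Z(Φ_b)`. [folklore] -/
theorem enstrophy_carrierAt (hL : 0 < L) :
    ∫ x, ‖curl (carrierAt b L) x‖ ^ 2 = L * ∫ x, ‖curl (carrier b) x‖ ^ 2 := by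
  have hpt : ∀ x, ‖curl (carrierAt b L) x‖ ^ 2 = L⁻¹ ^ 2 * (fun y => ‖curl (carrier b) y‖ ^ 2) (L⁻¹ • x) := by
    intro x
    rw [curl_carrierAt b hL, norm_smul, Real.norm_eq_abs, abs_of_pos (inv_pos.2 hL), mul_pow]
  simp_rw [hpt]
  rw [integral_const_mul, show (∫ x : E3, ‖curl (carrier b) (L⁻¹ • x)‖ ^ 2) = (L⁻¹ ^ 3)⁻¹ * ∫ x, ‖curl (carrier b) x‖ ^ 2
    from DepletionLadder.integral_comp_smul_three (inv_pos.2 hL) (fun y => ‖curl (carrier b) y‖ ^ 2)]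
  field_simp

/-- **Palinstrophy scales like `1/L`:** `P(Φ_{b,L}) = P(Φ_b) / L`. [folklore] -/
theorem palinstrophy_carrierAt (hL : 0 < L) :
    ∫ x, frobeniusNormSq (fderiv ℝ (curl (carrierAt b L)) x) =
      L⁻¹ * ∫ x, frobeniusNormSq (fderiv ℝ (curl (carrier b)) x) := by
  have hpt : ∀ x, frobeniusNormSq (fderiv ℝ (curl (carrierAt b L)) x) =
      (L⁻¹ * L⁻¹) ^ 2 * (fun y => frobeniusNormSq (fderiv ℝ (curl (carrier b)) y)) (L⁻¹ • x) := by
    intro x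
    rw [fderiv_curl_carrierAt b hL, frobeniusNormSq_smul]
  simp_rw [hpt]
  rw [integral_const_mul, show (∫ x : E3, frobeniusNormSq (fderiv ℝ (curl (carrier b)) (L⁻¹ • x))) =
    (L⁻¹ ^ 3)⁻¹ * ∫ x, frobeniusNormSq (fderiv ℝ (curl (carrier b)) x)
    from DepletionLadder.integral_comp_smul_three (inv_pos.2 hL) (fun y => frobeniusNormSq (fderiv ℝ (curl (carrier b)) y))]
  field_simp

/-- **The stretching integral is scale invariant:** `S(Φ_{b,L}) = S(Φ_b)`. [folklore] -/
theorem stretching_carrierAt (hL : 0 < L) :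
    ∫ x, ⟪curl (carrierAt b L) x, fderiv ℝ (carrierAt b L) x (curl (carrierAt b L) x)⟫ =
      ∫ x, ⟪curl (carrier b) x, fderiv ℝ (carrier b) x (curl (carrier b) x)⟫ := by
  have hpt : ∀ x, ⟪curl (carrierAt b L) x, fderiv ℝ (carrierAt b L) x (curl (carrierAt b L) x)⟫ =
      L⁻¹ ^ 3 * (fun y => ⟪curl (carrier b) y, fderiv ℝ (carrier b) y (curl (carrier b) y)⟫) (L⁻¹ • x) := by
    intro x
    rw [curl_carrierAt b hL, fderiv_carrierAt b hL, FunLike.coe_smul, Pi.smul_apply, map_smul,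
      real_inner_smul_left, real_inner_smul_right, real_inner_smul_right]
    ring
  simp_rw [hpt]
  rw [integral_const_mul, show (∫ x : E3, ⟪curl (carrier b) (L⁻¹ • x), fderiv ℝ (carrier b) (L⁻¹ • x) (curl (carrier b) (L⁻¹ • x))⟫) =
    (L⁻¹ ^ 3)⁻¹ * ∫ x, ⟪curl (carrier b) x, fderiv ℝ (carrier b) x (curl (carrier b) x)⟫
    from DepletionLadder.integral_comp_smul_three (inv_pos.2 hL)
      (fun y => ⟪curl (carrier b) y, fderiv ℝ (carrier b) y (curl (carrier b) y)⟫)]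
  field_simp

end ExtremiserLiouville

end Summit.NavierStokesRegularity.NavierStokesRegularity.Theorems

end
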